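import Literature.AlgebraicGeometry.HodgeTheory.AlgebraicCechDeRhamComparison
import Literature.AlgebraicGeometry.HodgeTheory.RegularFormRealizationAffineSpace
import HarnessLib

/-!
# Pull-back of the Čech–de Rham double complexes along a morphism of covered varieties, and the
# torsor step of the algebraic de Rham comparison

[topic AlgebraicGeometry/HodgeTheory]

Let `h : Y ⟶ X` be a morphism of smooth `ℂ`-schemes, `𝔘 = (U_i)_{i ∈ ι}` opens of `X` and
`𝔙 = (V_j)_{j ∈ ι'}` opens of `Y` with affine finite intersections (`IsAffineCover`), and
`τ : ι' → ι` with `V_j ⊆ h⁻¹ U_{τ j}` — a MORPHISM OF COVERED SCHEMES (for `h = 𝟙` a refinement,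
for `τ = id` the pull-back of a cover). The tree has, for one covered scheme, the algebraic
Čech–de Rham double complex `Č(𝔘, Ω•_alg)` on embedded carriers (`HodgeTheory/AlgebraicCechDeRham`,
[CattaniElZeinGriffithsLe2014, Ch. 2 §2.9.2 (p. 109)], [Grothendieck1966, p. 96 (6)]), its
REALISATION `realizeHom : Č(𝔘, Ω•_alg) → Č(𝔘^an, Ω•_smooth)` and the realisation map of Route P
`realizeDeRham : Hⁿ(Tot Č(𝔘, Ω•_alg)) → Hⁿ(Ω•(X^an), d)` (`HodgeTheory/AlgebraicCechDeRhamRealization`),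
and for an AFFINE `X` with a finite basic-open cover the identification of the realised classes with
the image of Grothendieck's comparison map `deRhamComparison` (`HodgeTheory/AlgebraicCechDeRhamComparison`,
`range_realizeDeRham_eq_of_basicCover`). This file makes all of it FUNCTORIAL along `(h, τ)` and
derives the torsor step of the lane's Route P (DAG-B §9A node P5):

* §0 `Motives.openSubschemeOverResLE h e : Y|_V ⟶ X|_U` (`V ⊆ h⁻¹U`; Mathlib `Scheme.Hom.resLE` over
  `ℂ`), `openSubschemeOverResLE_comp_ι`, `openSubschemeOverHomOfLE_comp_resLE`;
* §1 (generic manifolds, `Literature.Geometry.Kaehler`) the pull-back of LOCAL forms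
  `pullbackOn : Ω^k(W) → Ω^k(W')` along a `C^∞` map `f : N → M` with `W' ⊆ f⁻¹W` (pull back and cut
  off; [WarnerGTM94, 2.22–2.23] pointwise: `MForm.SmoothAt.pullback`, `mextDeriv_pullback_apply`),
  `localD_pullbackOn` (`d` commutes), and the induced MORPHISM OF ČECH–DE RHAM DOUBLE COMPLEXES
  **`cechPullbackHom : Č(𝔘, Ω_M) → Č(𝔙, Ω_N)`** of [BottTu1982Forms, §8] together with the morphism of
  row augmentations `cechPullbackRowHom` (pull-back of global forms), whose map on `Hⁿ(Ω•(M; ℂ), d)`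
  is `complexDeRhamCohomology.map f` (`localCohomologyEquivComplexDeRham_cohMap_cechPullbackRowHom`);
  `MForm.extendZero_pullback_of_val_comp` (extension by zero vs. pull-back along maps of open pieces);
* §2 the pull-back of ALGEBRAIC Čech cochains: `CoverCharts.liftAlong` / `pull CX CY h τ hτ J q :
  Ω^q(U_{τJ}) → Ω^q(V_J)` (`RegularForm.comap` along a polynomial lift of `h| : Y|_{V_J} ⟶ X|_{U_{τJ}}`,
  independent of the lift — `pull_eq_comap`, [Hartshorne1975, Ch. II §1 Thm. (1.4)]), `d_pull`,
  `res_comp_pull` (compatible with the restrictions, by `RegularForm.comap_comp` and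
  `cechIncl_comp_cechResLE`), and **`CoverCharts.pullbackHom CX CY h τ hτ : Č(𝔘, Ω•_{alg,X}) → Č(𝔙, Ω•_{alg,Y})`**
  (+ `pullbackHomℝ` over `ℝ`);
* §3 the realisations INTERTWINE the two pull-backs: `(h|)^an = h^an` on the open pieces
  (`AnalyticModel.val_comp_anMap_restrictOpen_resLE`, [SerreGAGA1956, §2 n°5]), `realizeOn_pull`
  (naturality of Grothendieck's (5) along `h|`, node P2-nat `regularFormRealize_pullback_anMap`), hence
  `realize_pullbackForms : realize_Y ∘ h^*_alg = (h^an)^* ∘ realize_X`;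
* §4 on cohomology: `ADoubleComplex.Hom.totCohMap_comm` (commuting squares of double-complex maps
  pass to `Hⁿ(Tot)`), **`CoverCharts.realizeDeRham_totCohMap_pullbackHomℝ`**
  (`realizeDeRham_Y ∘ Hⁿ(Tot h^*) = Hⁿ((h^an)^*) ∘ realizeDeRham_X`, by naturality and bijectivity of the
  smooth edge maps, [BottTu1982Forms, Prop. 8.8]), `CoverCharts.map_anMap_realizeDeRham` (the same in
  `complexDeRhamCohomology`), and the cover-independence under refinement
  `CoverCharts.localCohomologyEquivComplexDeRham_realizeDeRham_refine`;
* §5 **the torsor step** [Grothendieck1966, p. 96 (4): «if X is affine … ℍ(X) = H(Γ(X, Ω•_X))»;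
  CattaniElZeinGriffithsLe2014, §2.9.2: «by Serre's vanishing theorem for an affine variety, Ω•_alg is
  acyclic on an affine open cover»]: for `Y` smooth AFFINE with onto presentation `φ_{y₀}`, every
  `h⁻¹𝔘` has a finite BASIC-OPEN refinement (`exists_basicCover_refining`), so
  **`map_anMap_realizeDeRham_mem_range_deRhamComparison`**: `(h^an)^*(realizeDeRham_X c)` lies in the
  image of `deRhamComparison B y₀` — it is the class of ONE global closed algebraic form on `Y`
  (`exists_realize_eq_map_anMap_realizeDeRham` in the language of form expressions); and the ASSEMBLY
  of Route P modulo its analytic half: if `realizeDeRham_X` is onto (nodes P3–P4) and `(h^an)^*` is onto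
  (Jouanolou's torsor), then `deRhamComparison B y₀` is onto and (G) holds for `(Y, B, n)`
  (`surjective_deRhamComparison_of_surjective_realizeDeRham`, `exists_realize_eq_of_surjective_realizeDeRham`)
  — [Grothendieck1966, Thm. 1′] for the torsor WITHOUT resolution of singularities.

Everything is proved; definitions with bodies; no named facts (net debt 0). NOT here: the
surjectivity of `realizeDeRham` for projective `X` (GAGA on `E₁` and the Dolbeault comparison, nodes
P3–P4), and anything on the fact (G) `grothendieck_comparison_realize_surjective` for a general affine `Y`.

## References

* [Grothendieck1966] A. Grothendieck, *On the de Rham cohomology of algebraic varieties*, Publ.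
  Math. IHÉS 29 (1966), p. 96 (4)–(6), Thm. 1′.
* [CattaniElZeinGriffithsLe2014] E. Cattani, F. El Zein, P. Griffiths, Lê D. T. (eds.), *Hodge
  Theory*, Princeton Math. Notes 49 (2014), Ch. 2 (F. El Zein, L. Tu) §2.9.2, p. 109, (2.9.1)–(2.9.2).
* [Hartshorne1975] R. Hartshorne, *On the De Rham cohomology of algebraic varieties*, Publ. Math.
  IHÉS 45 (1975), Ch. II §1, Thm. (1.4) (functoriality of algebraic de Rham cohomology).
* [BottTu1982Forms] R. Bott, L. W. Tu, *Differential Forms in Algebraic Topology*, §I.2 (pull-back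
  of forms), §8 (8.1)–(8.4), Prop. 8.5, Prop. 8.8.
* [SerreGAGA1956] J.-P. Serre, *Géométrie algébrique et géométrie analytique*, §2 n°5.
* [Weibel1994] C. Weibel, *An Introduction to Homological Algebra*, 1.2.4–1.2.6, Lemma 2.7.3.
* [Hartshorne1977] R. Hartshorne, *Algebraic Geometry*, II §2 Prop. 2.2, II §3, II Ex. 4.3.
* [WarnerGTM94] F. Warner, *Foundations of Differentiable Manifolds and Lie Groups*, 2.22–2.23.
-/

noncomputable section

universe u v

open scoped Manifold ContDiff Topology
open Set CategoryTheory AlgebraicGeometry MvPolynomial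
open Literature.Algebra.Homology

/-! ### §0 Restriction of a morphism to opens, over `ℂ` -/

namespace Literature.AlgebraicGeometry.Motives

variable {X Y : SchemeOver ℂ} (h : Y ⟶ X)

/-- **The restriction `h| : Y|_V ⟶ X|_U` of a `ℂ`-morphism to opens with `V ⊆ h⁻¹ U`** (Mathlib
`Scheme.Hom.resLE`), as a morphism over `ℂ`. [cite: Hartshorne1977, II §3] -/
def openSubschemeOverResLE {U : X.left.Opens} {V : Y.left.Opens} (e : V ≤ h.left ⁻¹ᵁ U) :
    openSubschemeOver Y V ⟶ openSubschemeOver X U :=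
  Over.homMk (h.left.resLE U V e) (by
    change h.left.resLE U V e ≫ U.ι ≫ X.hom = V.ι ≫ Y.hom
    rw [← Category.assoc, Scheme.Hom.resLE_comp_ι, Category.assoc]
    have hw : h.left ≫ X.hom = Y.hom := Over.w h
    rw [hw])

/-- The underlying morphism of `openSubschemeOverResLE` is `Scheme.Hom.resLE` (`rfl`). [cite: Hartshorne1977, II §3] -/
@[simp]
theorem openSubschemeOverResLE_left {U : X.left.Opens} {V : Y.left.Opens} (e : V ≤ h.left ⁻¹ᵁ U) :
    (openSubschemeOverResLE h e).left = h.left.resLE U V e :=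
  rfl

/-- `Y|_V ⟶ X|_U ⟶ X` is `Y|_V ⟶ Y ⟶ X`. [cite: Hartshorne1977, II §3] -/
theorem openSubschemeOverResLE_comp_ι {U : X.left.Opens} {V : Y.left.Opens} (e : V ≤ h.left ⁻¹ᵁ U) :
    openSubschemeOverResLE h e ≫ openSubschemeOverι X U = openSubschemeOverι Y V ≫ h := by
  ext : 1
  rw [Over.comp_left, Over.comp_left, openSubschemeOverResLE_left, openSubschemeOverι_left,
    openSubschemeOverι_left]
  exact Scheme.Hom.resLE_comp_ι _ _

/-- **Restrictions commute with the inclusions of smaller opens**: for `U₁ ≤ U₂`, `V₁ ≤ V₂`,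
`Vᵢ ⊆ h⁻¹ Uᵢ`, the square `Y|_{V₁} ⟶ Y|_{V₂} ⟶ X|_{U₂}` = `Y|_{V₁} ⟶ X|_{U₁} ⟶ X|_{U₂}` commutes
(both are `h` restricted to `V₁`). [cite: Hartshorne1977, II §3] -/
theorem openSubschemeOverHomOfLE_comp_resLE {U₁ U₂ : X.left.Opens} {V₁ V₂ : Y.left.Opens}
    (hU : U₁ ≤ U₂) (hV : V₁ ≤ V₂) (e₁ : V₁ ≤ h.left ⁻¹ᵁ U₁) (e₂ : V₂ ≤ h.left ⁻¹ᵁ U₂) :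
    openSubschemeOverHomOfLE Y hV ≫ openSubschemeOverResLE h e₂ =
      openSubschemeOverResLE h e₁ ≫ openSubschemeOverHomOfLE X hU := by
  ext : 1
  rw [Over.comp_left, Over.comp_left, openSubschemeOverHomOfLE_left, openSubschemeOverResLE_left,
    openSubschemeOverResLE_left, openSubschemeOverHomOfLE_left]
  exact (Scheme.Hom.map_resLE _ _ _).trans (Scheme.Hom.resLE_map _ _ _).symm

/-- Membership in a preimage open: `y ∈ h⁻¹ U ↔ h(y) ∈ U`. [cite: Hartshorne1977, II §3] -/
theorem mem_preimage_opens_iff (U : X.left.Opens) (y : Y.left) :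
    y ∈ h.left ⁻¹ᵁ U ↔ h.left.base y ∈ U :=
  Iff.rfl

end Literature.AlgebraicGeometry.Motives

/-! ### §1 Pull-back of local forms and of the smooth Čech–de Rham double complex -/

namespace Literature.Geometry.Kaehler

/-- `N ⊆ f⁻¹ M`: the whole space pulls back to the whole space (private helper). [folklore] -/
private theorem univ_subset_preimage_univ {α β : Type*} (f : α → β) : (univ : Set α) ⊆ f ⁻¹' (univ : Set β) :=
  fun y _ ↦ show f y ∈ (univ : Set β) from mem_univ _

section Smooth

variable {E : Type*} [NormedAddCommGroup E] [NormedSpace ℝ E]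
  {H : Type*} [TopologicalSpace H] {I : ModelWithCorners ℝ E H}
  {M : Type*} [TopologicalSpace M] [ChartedSpace H M]
  {E' : Type*} [NormedAddCommGroup E'] [NormedSpace ℝ E']
  {H' : Type*} [TopologicalSpace H'] {I' : ModelWithCorners ℝ E' H'}
  {N : Type*} [TopologicalSpace N] [ChartedSpace H' N]
  {F : Type*} [NormedAddCommGroup F] [NormedSpace ℝ F]
  {ι ι' : Type*} {k : ℕ}

/-- **Cutting off after pulling back does not see the values outside**: for `W' ⊆ f⁻¹ W`,
`(f^*(β|_W))|_{W'} = (f^*β)|_{W'}`. [cite: BottTu1982Forms, §I.2] -/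
theorem MForm.restr_pullback_restr_of_subset_preimage {W : Set M} {W' : Set N} {f : N → M}
    (h : W' ⊆ f ⁻¹' W) (β : MForm I M F k) :
    ((β.restr W).pullback I' f).restr W' = (β.pullback I' f).restr W' := by
  funext y
  by_cases hy : y ∈ W'
  · rw [MForm.restr_apply_of_mem _ hy, MForm.restr_apply_of_mem _ hy]
    ext v
    rw [MForm.pullback_apply, MForm.pullback_apply, MForm.restr_apply_of_mem _ (show f y ∈ W from h hy)]
  · rw [MForm.restr_apply_of_notMem _ hy, MForm.restr_apply_of_notMem _ hy]

variable [IsManifold I ∞ M] [IsManifold I' ∞ N]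

/-- **The pull-back of a local form is a local form**: for `f : N → M` of class `C^∞`, `W' ⊆ f⁻¹ W`
open and `β ∈ Ω^k(W)` (smooth on `W`, zero off `W`), `(f^*β)|_{W'} ∈ Ω^k(W')` (Warner 2.22 at the
points of `W'`). [cite: WarnerGTM94, 2.22] [cite: BottTu1982Forms, §I.2] -/
theorem pullback_restr_mem_smoothFormsOn {f : N → M} (hf : ContMDiff I' I ∞ f) {W : Set M}
    {W' : Set N} (hW' : IsOpen W') (h : W' ⊆ f ⁻¹' W) {β : MForm I M F k}
    (hβ : β ∈ smoothFormsOn I F W k) : (β.pullback I' f).restr W' ∈ smoothFormsOn I' F W' k :=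
  ⟨fun y hy ↦ (MForm.smoothAt_restr_iff hW' _ hy).2
      (MForm.SmoothAt.pullback (Filter.Eventually.of_forall fun z ↦ hf z) (hβ.1 (f y) (h hy))),
    fun _ hy ↦ MForm.restr_apply_of_notMem _ hy⟩

variable (I I') in
/-- **The pull-back `f^* : Ω^k(W) → Ω^k(W')`** of local forms along a `C^∞` map `f : N → M` with
`W' ⊆ f⁻¹ W` (pull back, then cut off to `W'`), `ℝ`-linear — the restriction maps of the de Rham
complex made functorial in the manifold. [cite: BottTu1982Forms, §I.2] -/
def pullbackOn {f : N → M} (hf : ContMDiff I' I ∞ f) {W : Set M} {W' : Set N} (hW' : IsOpen W')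
    (h : W' ⊆ f ⁻¹' W) (k : ℕ) : smoothFormsOn I F W k →ₗ[ℝ] smoothFormsOn I' F W' k where
  toFun β := ⟨((β : MForm I M F k).pullback I' f).restr W', pullback_restr_mem_smoothFormsOn hf hW' h β.2⟩
  map_add' a b := Subtype.ext (by
    change (((a : MForm I M F k) + (b : MForm I M F k)).pullback I' f).restr W' =
      ((a : MForm I M F k).pullback I' f).restr W' + ((b : MForm I M F k).pullback I' f).restr W'
    rw [MForm.pullback_add, MForm.restr_add])
  map_smul' c a := Subtype.ext (by
    change ((c • (a : MForm I M F k)).pullback I' f).restr W' =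
      c • ((a : MForm I M F k).pullback I' f).restr W'
    rw [MForm.pullback_smul, MForm.restr_smul])

/-- Underlying form of `pullbackOn`. [cite: BottTu1982Forms, §I.2] -/
@[simp]
theorem coe_pullbackOn {f : N → M} (hf : ContMDiff I' I ∞ f) {W : Set M} {W' : Set N}
    (hW' : IsOpen W') (h : W' ⊆ f ⁻¹' W) (β : smoothFormsOn I F W k) :
    (pullbackOn I I' hf hW' h k β : MForm I' N F k) = ((β : MForm I M F k).pullback I' f).restr W' :=
  rfl

/-- **`d` commutes with the pull-back of local forms**: `d_{W'} (f^*β) = f^*(d_W β)` (Warner,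
Prop. 2.23, at the points of `W'`, where `β` is smooth at the image point). [cite: WarnerGTM94, Prop. 2.23] -/
theorem localD_pullbackOn {f : N → M} (hf : ContMDiff I' I ∞ f) {W : Set M} {W' : Set N}
    (hW : IsOpen W) (hW' : IsOpen W') (h : W' ⊆ f ⁻¹' W) (β : smoothFormsOn I F W k) :
    localD I' F k hW' (pullbackOn I I' hf hW' h k β) =
      pullbackOn I I' hf hW' h (k + 1) (localD I F k hW β) := by
  refine Subtype.ext (funext fun y ↦ ?_)
  by_cases hy : y ∈ W'
  · have hfy : f y ∈ W := h hy
    rw [coe_localD, coe_pullbackOn, coe_pullbackOn, MForm.restr_apply_of_mem _ hy,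
      MForm.restr_apply_of_mem _ hy, mextDeriv_restr_apply hW' _ hy,
      mextDeriv_pullback_apply (Filter.Eventually.of_forall fun z ↦ (hf z : ContMDiffAt I' I ∞ f z))
        (β.2.1 (f y) hfy)]
    ext v
    rw [MForm.pullback_apply, MForm.pullback_apply, coe_localD, MForm.restr_apply_of_mem _ hfy]
  · simp only [coe_localD, coe_pullbackOn, MForm.restr_apply_of_notMem _ hy]

/-- **Restriction then pull-back is pull-back then restriction** (`W₁ ⊆ W₂`, `W₁' ⊆ W₂'`,
`Wᵢ' ⊆ f⁻¹ Wᵢ`). [cite: BottTu1982Forms, §I.2] -/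
theorem pullbackOn_restrictₗ {f : N → M} (hf : ContMDiff I' I ∞ f) {W₁ W₂ : Set M} {W₁' W₂' : Set N}
    (hW₁ : IsOpen W₁) (hW₁' : IsOpen W₁') (hW₂' : IsOpen W₂') (hW : W₁ ⊆ W₂) (hW' : W₁' ⊆ W₂')
    (h₁ : W₁' ⊆ f ⁻¹' W₁) (h₂ : W₂' ⊆ f ⁻¹' W₂) (β : smoothFormsOn I F W₂ k) :
    pullbackOn I I' hf hW₁' h₁ k (restrictₗ I F k hW₁ hW β) =
      restrictₗ I' F k hW₁' hW' (pullbackOn I I' hf hW₂' h₂ k β) := by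
  apply Subtype.ext
  rw [coe_pullbackOn, coe_restrictₗ, coe_restrictₗ, coe_pullbackOn,
    MForm.restr_pullback_restr_of_subset_preimage h₁, MForm.restr_restr_of_subset hW']

/-! #### The Čech–de Rham double complex is contravariant in the covered manifold -/

section Cech

variable {U : ι → Set M} {V : ι' → Set N} {f : N → M} {τ : ι' → ι}

omit [TopologicalSpace M] [TopologicalSpace N] [IsManifold I ∞ M] [IsManifold I' ∞ N]
  [ChartedSpace H M] [ChartedSpace H' N] in
/-- `V_J ⊆ f⁻¹ U_{τ ∘ J}` for every tuple `J`, when `V_j ⊆ f⁻¹ U_{τ j}` for every `j`.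
[cite: BottTu1982Forms, §8 (8.1)] -/
theorem cechSet_subset_preimage_cechSet (hτ : ∀ j, V j ⊆ f ⁻¹' U (τ j)) {n : ℕ} (J : Fin n → ι') :
    cechSet V J ⊆ f ⁻¹' cechSet U (τ ∘ J) :=
  fun _ hy ↦ mem_cechSet_iff.2 fun l ↦ hτ (J l) (mem_cechSet_iff.1 hy l)

variable (I I' F) in
/-- **The pull-back of Čech cochains of forms** along `(f, τ)` — `f : N → M` of class `C^∞`,
`τ : ι' → ι` with `V_j ⊆ f⁻¹ U_{τ j}` (a refinement when `f = id`): `(f^* c)_J = f^*(c_{τ ∘ J})|_{V_J}`.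
[cite: BottTu1982Forms, §8 (8.1)] [cite: BottTu1982Forms, §I.2] -/
def cechPullback (hV : ∀ j, IsOpen (V j)) (hf : ContMDiff I' I ∞ f) (τ : ι' → ι)
    (hτ : ∀ j, V j ⊆ f ⁻¹' U (τ j)) (p q : ℕ) : CechForms I F U p q →ₗ[ℝ] CechForms I' F V p q where
  toFun c J := pullbackOn I I' hf (isOpen_cechSet hV J) (cechSet_subset_preimage_cechSet hτ J) q
    (c (τ ∘ J))
  map_add' c c' := by
    funext J
    simp only [Pi.add_apply, map_add]
  map_smul' r c := by
    funext J
    simp only [Pi.smul_apply, map_smul, RingHom.id_apply]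

/-- Components of the pull-back of Čech cochains, on underlying forms. [cite: BottTu1982Forms, §8 (8.1)] -/
@[simp]
theorem coe_cechPullback_apply (hV : ∀ j, IsOpen (V j)) (hf : ContMDiff I' I ∞ f) (τ : ι' → ι)
    (hτ : ∀ j, V j ⊆ f ⁻¹' U (τ j)) {p q : ℕ} (c : CechForms I F U p q) (J : Fin (p + 1) → ι') :
    (cechPullback I I' F hV hf τ hτ p q c J : MForm I' N F q) =
      ((c (τ ∘ J) : MForm I M F q).pullback I' f).restr (cechSet V J) :=
  rfl

/-- Sanity check: **the pull-back along `(id, id)` is the identity** (`id^* ω = ω`, and a form on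
`U_J` is its own cut-off). [cite: BottTu1982Forms, §I.2] -/
theorem cechPullback_id (hU : ∀ i, IsOpen (U i)) (p q : ℕ) (c : CechForms I F U p q) :
    cechPullback I I F hU contMDiff_id id (fun _ _ hx ↦ hx) p q c = c := by
  funext J
  apply Subtype.ext
  rw [coe_cechPullback_apply]
  change (((c J : smoothFormsOn I F (cechSet U J) q) : MForm I M F q).pullback I id).restr (cechSet U J) =
    (c J : MForm I M F q)
  rw [MForm.pullback_id, restr_eq_self_of_mem (c J).2]

/-- **The pull-back commutes with the vertical differentials** `(-1)^p d`. [cite: WarnerGTM94, Prop. 2.23] -/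
theorem cechPullback_cechd (hU : ∀ i, IsOpen (U i)) (hV : ∀ j, IsOpen (V j))
    (hf : ContMDiff I' I ∞ f) (τ : ι' → ι) (hτ : ∀ j, V j ⊆ f ⁻¹' U (τ j)) (p q : ℕ)
    (c : CechForms I F U p q) :
    cechPullback I I' F hV hf τ hτ p (q + 1) (cechd I F hU p q c) =
      cechd I' F hV p q (cechPullback I I' F hV hf τ hτ p q c) := by
  funext J
  change pullbackOn I I' hf (isOpen_cechSet hV J) (cechSet_subset_preimage_cechSet hτ J) (q + 1)
      (cechd I F hU p q c (τ ∘ J)) = _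
  rw [cechd_apply, cechd_apply, map_smul, ← localD_pullbackOn]
  rfl

/-- **The pull-back commutes with the Čech differentials**: `f^*(c_{(τJ) ∘ σ_j}|_{U_{τJ}})|_{V_J} =
(f^* c)_{J ∘ σ_j}|_{V_J}`. [cite: BottTu1982Forms, §8 (8.4)] -/
theorem cechPullback_cechδ (hU : ∀ i, IsOpen (U i)) (hV : ∀ j, IsOpen (V j))
    (hf : ContMDiff I' I ∞ f) (τ : ι' → ι) (hτ : ∀ j, V j ⊆ f ⁻¹' U (τ j)) (p q : ℕ)
    (c : CechForms I F U p q) :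
    cechPullback I I' F hV hf τ hτ (p + 1) q (cechδ I F hU p q c) =
      cechδ I' F hV p q (cechPullback I I' F hV hf τ hτ p q c) := by
  funext J
  apply Subtype.ext
  rw [coe_cechPullback_apply, coe_cechδ_apply, coe_cechδ_apply, ← MForm.pullbackₗ_apply, map_sum,
    MForm.restr_sum]
  refine Finset.sum_congr rfl fun j _ ↦ ?_
  rw [map_smul, MForm.restr_smul, MForm.pullbackₗ_apply,
    MForm.restr_pullback_restr_of_subset_preimage (cechSet_subset_preimage_cechSet hτ J),
    coe_cechPullback_apply, MForm.restr_restr_of_subset (cechSet_subset_comp V J (Fin.succAbove j))]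
  rfl

variable (I I' F) in
/-- **The pull-back is a morphism of Čech–de Rham double complexes**
`C(𝔘, Ω_M) → C(𝔙, Ω_N)` along `(f, τ)`. [cite: BottTu1982Forms, §8] [cite: Weibel1994, 1.2.4] -/
def cechPullbackHom (hU : ∀ i, IsOpen (U i)) (hV : ∀ j, IsOpen (V j)) (hf : ContMDiff I' I ∞ f)
    (τ : ι' → ι) (hτ : ∀ j, V j ⊆ f ⁻¹' U (τ j)) : (cechDeRham I F hU).Hom (cechDeRham I' F hV) where
  f p q := cechPullback I I' F hV hf τ hτ p q
  f_d p q c := cechPullback_cechd hU hV hf τ hτ p q c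
  f_δ p q c := cechPullback_cechδ hU hV hf τ hτ p q c

/-- Components of `cechPullbackHom` (definitional). [cite: BottTu1982Forms, §8] -/
@[simp]
theorem cechPullbackHom_f (hU : ∀ i, IsOpen (U i)) (hV : ∀ j, IsOpen (V j))
    (hf : ContMDiff I' I ∞ f) (τ : ι' → ι) (hτ : ∀ j, V j ⊆ f ⁻¹' U (τ j)) (p q : ℕ) :
    (cechPullbackHom I I' F hU hV hf τ hτ).f p q = cechPullback I I' F hV hf τ hτ p q :=
  rfl

variable (I I' F) in
/-- **The pull-back of global forms is a morphism of row augmentations** over `cechPullbackHom`: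
`f^* : Ω•(M) → Ω•(N)` commutes with `d` and with the restrictions to the open pieces
(`(f^*ω)|_{V_J} = f^*(ω|_{U_{τJ}})|_{V_J}`). [cite: BottTu1982Forms, §8 Prop. 8.5] [cite: WarnerGTM94, Prop. 2.23] -/
def cechPullbackRowHom (hU : ∀ i, IsOpen (U i)) (hV : ∀ j, IsOpen (V j)) (hf : ContMDiff I' I ∞ f)
    (τ : ι' → ι) (hτ : ∀ j, V j ⊆ f ⁻¹' U (τ j)) :
    ADoubleComplex.RowAugmentation.Hom (cechDeRhamRow I F hU) (cechDeRhamRow I' F hV)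
      (cechPullbackHom I I' F hU hV hf τ hτ) where
  g q := pullbackOn I I' hf isOpen_univ (univ_subset_preimage_univ f) q
  g_dA q a := (localD_pullbackOn hf isOpen_univ isOpen_univ (univ_subset_preimage_univ f) a).symm
  ε_g q a := by
    funext J
    apply Subtype.ext
    rw [coe_cechDeRhamRow_ε, coe_pullbackOn, cechPullbackHom_f, coe_cechPullback_apply,
      coe_cechDeRhamRow_ε, MForm.restr_univ,
      MForm.restr_pullback_restr_of_subset_preimage (cechSet_subset_preimage_cechSet hτ J)]

/-- The augmentation component of `cechPullbackRowHom` is the global pull-back (definitional).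
[cite: BottTu1982Forms, §I.2] -/
@[simp]
theorem cechPullbackRowHom_g (hU : ∀ i, IsOpen (U i)) (hV : ∀ j, IsOpen (V j))
    (hf : ContMDiff I' I ∞ f) (τ : ι' → ι) (hτ : ∀ j, V j ⊆ f ⁻¹' U (τ j)) (q : ℕ) :
    (cechPullbackRowHom I I' F hU hV hf τ hτ).g q =
      pullbackOn I I' hf isOpen_univ (univ_subset_preimage_univ f) q :=
  rfl

end Cech

end Smooth

/-! #### Complex coefficients: the induced map is the pull-back on `complexDeRhamCohomology` -/

section Complex

variable {E : Type*} [NormedAddCommGroup E] [NormedSpace ℂ E]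
  {M : Type*} [TopologicalSpace M] [ChartedSpace E M] [IsManifold 𝓘(ℝ, E) ∞ M]
  {E' : Type*} [NormedAddCommGroup E'] [NormedSpace ℂ E']
  {N : Type*} [TopologicalSpace N] [ChartedSpace E' N] [IsManifold 𝓘(ℝ, E') ∞ N]
  {ι ι' : Type*} {U : ι → Set M} {V : ι' → Set N} {f : N → M}

omit [IsManifold 𝓘(ℝ, E) ∞ M] in
/-- A cocycle of `(Ω•(M; ℂ), d)` (forms on `univ`) is a closed complex form. [cite: BottTu1982Forms, §I.1] -/
theorem coe_mem_cclosedSmoothForms_of_mem_cocycles [IsManifold 𝓘(ℝ, E) ∞ M] {n : ℕ}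
    (z : NatCochain.cocycles (fun q ↦ localD 𝓘(ℝ, E) ℂ q (isOpen_univ : IsOpen (univ : Set M))) n) :
    ((z : smoothFormsOn 𝓘(ℝ, E) ℂ (univ : Set M) n) : MForm 𝓘(ℝ, E) M ℂ n) ∈
      Literature.NumberTheory.Transcendental.cclosedSmoothForms E M n := by
  have hz := (NatCochain.mem_cocycles_iff _).1 z.2
  have hd : mextDeriv ((z : smoothFormsOn 𝓘(ℝ, E) ℂ (univ : Set M) n) : MForm 𝓘(ℝ, E) M ℂ n) = 0 := by
    have h' := congrArg (fun s : smoothFormsOn 𝓘(ℝ, E) ℂ (univ : Set M) (n + 1) ↦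
      (s : MForm 𝓘(ℝ, E) M ℂ (n + 1))) hz
    simpa only [coe_localD, MForm.restr_univ, ZeroMemClass.coe_zero] using h'
  have hs : IsSmoothForm ((z : smoothFormsOn 𝓘(ℝ, E) ℂ (univ : Set M) n) : MForm 𝓘(ℝ, E) M ℂ n) := by
    rw [← mem_smoothForms_iff, ← smoothFormsOn_univ]
    exact (z : smoothFormsOn 𝓘(ℝ, E) ℂ (univ : Set M) n).2
  exact Literature.NumberTheory.Transcendental.mem_cclosedSmoothForms hs hd

/-- **On cohomology the pull-back of augmentations is `f^*` on complex de Rham cohomology**: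
`Hⁿ(f^*)` on `Hⁿ(Ω•(M; ℂ), d)`, read through `localCohomologyEquivComplexDeRham`, is
`complexDeRhamCohomology.map f`. [cite: BottTu1982Forms, §I.2] -/
theorem localCohomologyEquivComplexDeRham_cohMap_cechPullbackRowHom (hU : ∀ i, IsOpen (U i))
    (hV : ∀ j, IsOpen (V j)) (hf : ContMDiff 𝓘(ℝ, E') 𝓘(ℝ, E) ∞ f) (τ : ι' → ι)
    (hτ : ∀ j, V j ⊆ f ⁻¹' U (τ j)) (n : ℕ) (w : NatCochain.Cohomology (cechDeRhamRow 𝓘(ℝ, E) ℂ hU).dA n) :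
    localCohomologyEquivComplexDeRham n ((cechPullbackRowHom 𝓘(ℝ, E) 𝓘(ℝ, E') ℂ hU hV hf τ hτ).cohMap n w) =
      Literature.NumberTheory.Transcendental.complexDeRhamCohomology.map E' hf n
        (localCohomologyEquivComplexDeRham n w) := by
  obtain ⟨z, rfl⟩ := NatCochain.Cohomology.mk_surjective _ n w
  have hz := coe_mem_cclosedSmoothForms_of_mem_cocycles (E := E) (M := M) z
  have hz' : ((NatCochain.Cohomology.mapCocycles (cechPullbackRowHom 𝓘(ℝ, E) 𝓘(ℝ, E') ℂ hU hV hf τ hτ).g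
      (cechPullbackRowHom 𝓘(ℝ, E) 𝓘(ℝ, E') ℂ hU hV hf τ hτ).g_dA n z :
        smoothFormsOn 𝓘(ℝ, E') ℂ (univ : Set N) n) : MForm 𝓘(ℝ, E') N ℂ n) ∈
      Literature.NumberTheory.Transcendental.cclosedSmoothForms E' N n := by
    rw [NatCochain.Cohomology.coe_mapCocycles, cechPullbackRowHom_g, coe_pullbackOn, MForm.restr_univ]
    exact Literature.NumberTheory.Transcendental.pullback_mem_cclosedSmoothForms hf hz
  rw [ADoubleComplex.RowAugmentation.Hom.cohMap_mk]
  refine (localCohomologyEquivComplexDeRham_mk n _ hz').trans ?_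
  refine Eq.trans ?_ (congrArg (Literature.NumberTheory.Transcendental.complexDeRhamCohomology.map E' hf n)
    (localCohomologyEquivComplexDeRham_mk n z hz)).symm
  rw [Literature.NumberTheory.Transcendental.complexDeRhamCohomology.map_mk]
  congr 1
  apply Subtype.ext
  change ((((z : smoothFormsOn 𝓘(ℝ, E) ℂ (univ : Set M) n) : MForm 𝓘(ℝ, E) M ℂ n).pullback 𝓘(ℝ, E')
    f).restr univ) = _
  rw [MForm.restr_univ]

end Complex

/-! #### Extension by zero and pull-back along maps of open pieces -/

section ExtendZero

/-- **Extension by zero intertwines the pull-back along a map of open pieces with the ambient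
pull-back**: for opens `W ⊆ M`, `W' ⊆ N`, a map `f : N → M` differentiable on `W'` and
`g : W' → W` differentiable with `val ∘ g = f ∘ val`, and a form `β` on `↥W`:
`extendZero (g^*β) = (f^*(extendZero β))|_{W'}` (the inclusions of open submanifolds have identity
differentials). [cite: LeeSmoothManifolds2013, Prop. 3.9] [cite: WarnerGTM94, 2.22] -/
theorem MForm.extendZero_pullback_of_val_comp
    {EM : Type*} [NormedAddCommGroup EM] [NormedSpace ℝ EM] {M : Type*} [TopologicalSpace M]
    [ChartedSpace EM M] {EN : Type*} [NormedAddCommGroup EN] [NormedSpace ℝ EN] {N : Type*}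
    [TopologicalSpace N] [ChartedSpace EN N] {F : Type*} [NormedAddCommGroup F] [NormedSpace ℝ F]
    {W : TopologicalSpace.Opens M} {W' : TopologicalSpace.Opens N} {f : N → M} {g : W' → W}
    (hg : Subtype.val ∘ g = f ∘ Subtype.val) (hgd : MDifferentiable 𝓘(ℝ, EN) 𝓘(ℝ, EM) g)
    (hfd : ∀ y ∈ W', MDifferentiableAt 𝓘(ℝ, EN) 𝓘(ℝ, EM) f y) {k : ℕ} (β : MForm 𝓘(ℝ, EM) W F k) :
    (β.pullback 𝓘(ℝ, EN) g).extendZero = ((β.extendZero).pullback 𝓘(ℝ, EN) f).restr (W' : Set N) := by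
  funext y
  by_cases hy : y ∈ W'
  · have hgy : ((g ⟨y, hy⟩ : W) : M) = f y := congrFun hg ⟨y, hy⟩
    have hfy : f y ∈ W := hgy ▸ (g ⟨y, hy⟩).2
    -- the differentials agree: `dg = d(val ∘ g) = d(f ∘ val) = df`
    have hd : mfderiv 𝓘(ℝ, EN) 𝓘(ℝ, EM) g ⟨y, hy⟩ = mfderiv 𝓘(ℝ, EN) 𝓘(ℝ, EM) f y := by
      have h1 := mfderiv_comp (⟨y, hy⟩ : W')
        (Literature.Geometry.Manifold.OpenSubmanifold.mdifferentiableAt_subtype_val (g ⟨y, hy⟩)) (hgd _)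
      have h2 := mfderiv_comp (⟨y, hy⟩ : W') (hfd y hy :
        MDifferentiableAt 𝓘(ℝ, EN) 𝓘(ℝ, EM) f ((Subtype.val : W' → N) ⟨y, hy⟩))
        (Literature.Geometry.Manifold.OpenSubmanifold.mdifferentiableAt_subtype_val _)
      rw [Literature.Geometry.Manifold.OpenSubmanifold.mfderiv_subtype_val] at h1 h2
      rw [hg] at h1
      ext w
      have e1 := DFunLike.congr_fun h1 w
      have e2 := DFunLike.congr_fun h2 w
      exact e1.symm.trans e2
    rw [MForm.extendZero_apply_of_mem _ hy, MForm.restr_apply_of_mem _ hy]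
    change (β (g ⟨y, hy⟩)).compContinuousLinearMap (mfderiv 𝓘(ℝ, EN) 𝓘(ℝ, EM) g ⟨y, hy⟩) =
      (β.extendZero (f y)).compContinuousLinearMap (mfderiv 𝓘(ℝ, EN) 𝓘(ℝ, EM) f y)
    rw [hd, MForm.extendZero_apply_of_mem _ hfy]
    generalize g ⟨y, hy⟩ = w at hgy ⊢
    obtain ⟨wv, hwW⟩ := w
    change wv = f y at hgy
    subst hgy
    rfl
  · rw [MForm.extendZero_apply_of_notMem _ hy, MForm.restr_apply_of_notMem _ hy]

end ExtendZero

end Literature.Geometry.Kaehler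

/-! ### §2 Pull-back of the algebraic Čech–de Rham double complex along a morphism of covered schemes -/

namespace Literature.AlgebraicGeometry.HodgeTheory

open Literature.AlgebraicGeometry.Motives Literature.AlgebraicGeometry.Motives.AffineDeRham

section Algebraic

variable {X Y : Motives.SchemeOver ℂ} {ι : Type u} {ι' : Type v} {U : ι → X.left.Opens}
  {V : ι' → Y.left.Opens}

/-- `V_J ⊆ h⁻¹ U_{τ ∘ J}` for every tuple, when `V_j ⊆ h⁻¹ U_{τ j}` for every `j`.
[cite: Hartshorne1977, II Ex. 4.3] -/
theorem cechOpen_le_preimage_cechOpen (h : Y ⟶ X) {τ : ι' → ι} (hτ : ∀ j, V j ≤ h.left ⁻¹ᵁ U (τ j))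
    {n : ℕ} (J : Fin n → ι') : cechOpen V J ≤ h.left ⁻¹ᵁ cechOpen U (τ ∘ J) := fun y hy ↦ by
  rw [Motives.mem_preimage_opens_iff, mem_cechOpen_iff]
  exact fun l ↦ hτ (J l) ((mem_cechOpen_iff V J y).1 hy l)

/-- **The restriction `h| : Y|_{V_J} ⟶ X|_{U_{τJ}}`** of `h` to the finite intersections.
[cite: Hartshorne1977, II §3] -/
abbrev cechResLE (h : Y ⟶ X) (τ : ι' → ι) (hτ : ∀ j, V j ≤ h.left ⁻¹ᵁ U (τ j)) {n : ℕ}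
    (J : Fin n → ι') : cechScheme Y V J ⟶ cechScheme X U (τ ∘ J) :=
  Motives.openSubschemeOverResLE h (cechOpen_le_preimage_cechOpen h hτ J)

/-- The restrictions of `h` commute with the inclusions of the finite intersections:
`Y|_{V_J} ⟶ Y|_{V_{J∘θ}} ⟶ X|_{U_{τJθ}}` = `Y|_{V_J} ⟶ X|_{U_{τJ}} ⟶ X|_{U_{τJθ}}`.
[cite: Hartshorne1977, II §3] -/
theorem cechIncl_comp_cechResLE (h : Y ⟶ X) (τ : ι' → ι) (hτ : ∀ j, V j ≤ h.left ⁻¹ᵁ U (τ j))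
    {m n : ℕ} (J : Fin n → ι') (θ : Fin m → Fin n) :
    cechIncl Y V J θ ≫ cechResLE h τ hτ (J ∘ θ) = cechResLE h τ hτ J ≫ cechIncl X U (τ ∘ J) θ :=
  Motives.openSubschemeOverHomOfLE_comp_resLE h (cechOpen_le_comp U (τ ∘ J) θ) (cechOpen_le_comp V J θ)
    (cechOpen_le_preimage_cechOpen h hτ J) (cechOpen_le_preimage_cechOpen h hτ (J ∘ θ))

namespace CoverCharts

variable (CX : CoverCharts X U) (CY : CoverCharts Y V) (h : Y ⟶ X) (τ : ι' → ι)
  (hτ : ∀ j, V j ≤ h.left ⁻¹ᵁ U (τ j))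

/-- **Two polynomial lifts of one `ℂ`-morphism `g : Y|_{V_J} ⟶ X|_{U_K}` induce the same map on
regular forms** (`RegularForm.comap_congr`: the lifts agree modulo the relations of `V_J`).
[cite: Hartshorne1975, Ch. II §1, Thm. (1.4)] -/
theorem comap_eq_comap_of_lift {p p' : ℕ} {J : Fin (p + 1) → ι'} {K : Fin (p' + 1) → ι}
    (g : cechScheme Y V J ⟶ cechScheme X U K) {F F' : Fin (CX.N K) → MvPolynomial (Fin (CY.N J)) ℂ}
    (hF : ∀ j, g.left.appTop (CX.coord K j) = coordPresentation (cechScheme Y V J) (CY.coord J) (F j))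
    (hF' : ∀ j, g.left.appTop (CX.coord K j) = coordPresentation (cechScheme Y V J) (CY.coord J) (F' j))
    (hFI : (CX.ideal K).map (bind₁ F : MvPolynomial (Fin (CX.N K)) ℂ →ₐ[ℂ]
      MvPolynomial (Fin (CY.N J)) ℂ) ≤ CY.ideal J)
    (hFI' : (CX.ideal K).map (bind₁ F' : MvPolynomial (Fin (CX.N K)) ℂ →ₐ[ℂ]
      MvPolynomial (Fin (CY.N J)) ℂ) ≤ CY.ideal J) (q : ℕ) :
    RegularForm.comap F hFI q = RegularForm.comap F' hFI' q := by
  refine RegularForm.comap_congr hFI hFI' (fun j ↦ ?_) q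
  change F j - F' j ∈ RingHom.ker (coordPresentation (cechScheme Y V J) (CY.coord J))
  rw [RingHom.mem_ker, map_sub, ← hF j, ← hF' j, sub_self]

/-- A chosen polynomial lift of `h| : Y|_{V_J} ⟶ X|_{U_{τJ}}` on the charts `x_J` of `V_J` and
`x_{τJ}` of `U_{τJ}` (`exists_coordLift`: `h♯(x_{τJ,j}) = φ_{x_J}(F_j)`). [cite: Hartshorne1975, Ch. II §1] -/
def liftAlong {p : ℕ} (J : Fin (p + 1) → ι') : Fin (CX.N (τ ∘ J)) → MvPolynomial (Fin (CY.N J)) ℂ :=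
  (exists_coordLift (cechResLE h τ hτ J) (CY.surj J) (CX.coord (τ ∘ J))).choose

/-- The defining property of `liftAlong`. [cite: Hartshorne1975, Ch. II §1] -/
theorem liftAlong_spec {p : ℕ} (J : Fin (p + 1) → ι') (j : Fin (CX.N (τ ∘ J))) :
    (cechResLE h τ hτ J).left.appTop (CX.coord (τ ∘ J) j) =
      coordPresentation (cechScheme Y V J) (CY.coord J) (liftAlong CX CY h τ hτ J j) :=
  (exists_coordLift (cechResLE h τ hτ J) (CY.surj J) (CX.coord (τ ∘ J))).choose_spec j

/-- The lift carries the relations of `U_{τJ}` to relations of `V_J`. [cite: Hartshorne1975, Ch. II §1] -/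
theorem map_liftAlong_le {p : ℕ} (J : Fin (p + 1) → ι') :
    (CX.ideal (τ ∘ J)).map (bind₁ (liftAlong CX CY h τ hτ J) :
      MvPolynomial (Fin (CX.N (τ ∘ J))) ℂ →ₐ[ℂ] MvPolynomial (Fin (CY.N J)) ℂ) ≤ CY.ideal J :=
  map_le_ker_coordPresentation (cechResLE h τ hτ J) (liftAlong_spec CX CY h τ hτ J) le_rfl

/-- **The pull-back `h^* : Ω^q(U_{τJ}) → Ω^q(V_J)` of regular forms** along `h| : V_J → U_{τJ}`:
`RegularForm.comap` along the chosen lift (independent of the lift, `pull_eq_comap`).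
[cite: Hartshorne1975, Ch. II §1, Thm. (1.4)] [cite: GortzWedhorn2023, Prop. 17.56] -/
def pull {p : ℕ} (J : Fin (p + 1) → ι') (q : ℕ) :
    RegularForm (CX.ideal (τ ∘ J)) q →ₗ[ℂ] RegularForm (CY.ideal J) q :=
  RegularForm.comap (liftAlong CX CY h τ hτ J) (map_liftAlong_le CX CY h τ hτ J) q

/-- **`pull` is independent of the lift**: any polynomial lift of `h|` on the charts induces it.
[cite: Hartshorne1975, Ch. II §1, Thm. (1.4)] -/
theorem pull_eq_comap {p : ℕ} (J : Fin (p + 1) → ι') {F : Fin (CX.N (τ ∘ J)) → MvPolynomial (Fin (CY.N J)) ℂ}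
    (hF : ∀ j, (cechResLE h τ hτ J).left.appTop (CX.coord (τ ∘ J) j) =
      coordPresentation (cechScheme Y V J) (CY.coord J) (F j)) (q : ℕ) :
    pull CX CY h τ hτ J q =
      RegularForm.comap F (map_le_ker_coordPresentation (cechResLE h τ hτ J) hF le_rfl) q :=
  comap_eq_comap_of_lift CX CY (cechResLE h τ hτ J) (liftAlong_spec CX CY h τ hτ J) hF _ _ q

/-- `pull` on the class of a polynomial form. [cite: Hartshorne1975, Ch. II §1] -/
theorem pull_mk {p : ℕ} (J : Fin (p + 1) → ι') {q : ℕ} (α : PolyForm ℂ (CX.N (τ ∘ J)) q) :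
    pull CX CY h τ hτ J q (RegularForm.mk _ α) =
      RegularForm.mk _ (PolyForm.comap (liftAlong CX CY h τ hτ J) α) :=
  RegularForm.comap_mk _ _ α

/-- Sanity check: **the pull-back along `(𝟙 X, id)` is the identity** on each `Ω^q(U_J)` (the
variables `T_j` lift the identity; `RegularForm.comap_X_eq_id`). [cite: GortzWedhorn2023, Prop. 17.56] -/
theorem pull_id (C : CoverCharts X U) (hτ : ∀ i, U i ≤ (𝟙 X : X ⟶ X).left ⁻¹ᵁ U (id i)) {p : ℕ}
    (J : Fin (p + 1) → ι) (q : ℕ) : pull C C (𝟙 X) id hτ J q = LinearMap.id := by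
  have hleft : (cechResLE (𝟙 X) id hτ J).left = 𝟙 (cechScheme X U J).left := by
    change (𝟙 X.left : X.left ⟶ X.left).resLE _ _ _ = _
    rw [Scheme.Hom.resLE_id]
    exact Scheme.homOfLE_rfl _ _
  have hF : ∀ j, (cechResLE (𝟙 X) id hτ J).left.appTop (C.coord (id ∘ J) j) =
      coordPresentation (cechScheme X U J) (C.coord J) (MvPolynomial.X j) := fun j ↦ by
    rw [coordPresentation_X, hleft]
    rfl
  rw [pull_eq_comap C C (𝟙 X) id hτ J hF q]
  exact RegularForm.comap_X_eq_id _ q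

/-- **`pull` commutes with `d`.** [cite: Hartshorne1975, Ch. II §1] -/
theorem d_pull {p : ℕ} (J : Fin (p + 1) → ι') {q : ℕ} (r : RegularForm (CX.ideal (τ ∘ J)) q) :
    RegularForm.d (CY.ideal J) (pull CX CY h τ hτ J q r) = pull CX CY h τ hτ J (q + 1) (RegularForm.d _ r) :=
  RegularForm.d_comap _ _ r

/-- **`pull` commutes with the restrictions to the finite intersections**:
`Ω^q(U_{τJθ}) → Ω^q(V_{Jθ}) → Ω^q(V_J)` = `Ω^q(U_{τJθ}) → Ω^q(U_{τJ}) → Ω^q(V_J)` — both are the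
pull-back along the one morphism `Y|_{V_J} ⟶ X|_{U_{τJθ}}` (`cechIncl_comp_cechResLE`), and the
pull-back is functorial and lift-independent (`RegularForm.comap_comp`, `comap_congr`).
[cite: GortzWedhorn2023, Prop. 17.56] [cite: Hartshorne1975, Ch. II §1, Thm. (1.4)] -/
theorem res_comp_pull {p m : ℕ} (J : Fin (p + 1) → ι') (θ : Fin (m + 1) → Fin (p + 1)) (q : ℕ) :
    CY.res J θ q ∘ₗ pull CX CY h τ hτ (J ∘ θ) q = pull CX CY h τ hτ J q ∘ₗ CX.res (τ ∘ J) θ q := by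
  -- both composites are `comap` along a lift of `Y|_{V_J} ⟶ X|_{U_{τJθ}}`
  have h1 : ∀ j, (cechIncl Y V J θ ≫ cechResLE h τ hτ (J ∘ θ)).left.appTop (CX.coord (τ ∘ (J ∘ θ)) j) =
      coordPresentation (cechScheme Y V J) (CY.coord J)
        (bind₁ (CY.lift J θ) (liftAlong CX CY h τ hτ (J ∘ θ) j)) := fun j ↦ by
    rw [coordPresentation_bind₁ (cechIncl Y V J θ) (CY.lift_spec J θ),
      ← liftAlong_spec CX CY h τ hτ (J ∘ θ) j, Over.comp_left, Scheme.Hom.comp_appTop]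
    rfl
  have h2 : ∀ j, (cechResLE h τ hτ J ≫ cechIncl X U (τ ∘ J) θ).left.appTop (CX.coord ((τ ∘ J) ∘ θ) j) =
      coordPresentation (cechScheme Y V J) (CY.coord J)
        (bind₁ (liftAlong CX CY h τ hτ J) (CX.lift (τ ∘ J) θ j)) := fun j ↦ by
    rw [coordPresentation_bind₁ (cechResLE h τ hτ J) (liftAlong_spec CX CY h τ hτ J),
      ← CX.lift_spec (τ ∘ J) θ j, Over.comp_left, Scheme.Hom.comp_appTop]
    rfl
  have hI1 := map_le_ker_coordPresentation _ h1 (le_refl (CX.ideal (τ ∘ (J ∘ θ))))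
  have hI2 := map_le_ker_coordPresentation _ h2 (le_refl (CX.ideal ((τ ∘ J) ∘ θ)))
  refine (RegularForm.comap_comp _ _ _ _ hI1 (fun j ↦ by simp) q).trans
    ((comap_eq_comap_of_lift CX CY _ h1 (fun j ↦ ?_) hI1 hI2 q).trans
      (RegularForm.comap_comp _ _ _ _ hI2 (fun j ↦ by simp) q).symm)
  rw [cechIncl_comp_cechResLE h τ hτ J θ]
  exact h2 j

/-- `res ∘ pull = pull ∘ res`, applied. [cite: GortzWedhorn2023, Prop. 17.56] -/
theorem res_pull {p m : ℕ} (J : Fin (p + 1) → ι') (θ : Fin (m + 1) → Fin (p + 1)) {q : ℕ}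
    (r : RegularForm (CX.ideal (τ ∘ (J ∘ θ))) q) :
    CY.res J θ q (pull CX CY h τ hτ (J ∘ θ) q r) = pull CX CY h τ hτ J q (CX.res (τ ∘ J) θ q r) :=
  LinearMap.congr_fun (res_comp_pull CX CY h τ hτ J θ q) r

/-- **The pull-back of algebraic Čech cochains** `C^p(𝔘, Ω^q_alg) → C^p(𝔙, Ω^q_alg)`,
`(h^* c)_J = h|^*(c_{τ ∘ J})`. [cite: CattaniElZeinGriffithsLe2014, Ch. 2 §2.9.2 (p. 109)]
[cite: Hartshorne1975, Ch. II §1] -/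
def pullbackForms (p q : ℕ) : CX.Forms p q →ₗ[ℂ] CY.Forms p q where
  toFun c J := pull CX CY h τ hτ J q (c (τ ∘ J))
  map_add' c c' := by
    funext J
    simp only [Pi.add_apply, map_add]
  map_smul' a c := by
    funext J
    simp only [Pi.smul_apply, map_smul, RingHom.id_apply]

/-- Components of the pull-back of algebraic Čech cochains. [cite: Hartshorne1975, Ch. II §1] -/
@[simp]
theorem pullbackForms_apply {p q : ℕ} (c : CX.Forms p q) (J : Fin (p + 1) → ι') :
    pullbackForms CX CY h τ hτ p q c J = pull CX CY h τ hτ J q (c (τ ∘ J)) :=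
  rfl

/-- The pull-back commutes with the vertical differentials `(-1)^p d`. [cite: Hartshorne1975, Ch. II §1] -/
theorem pullbackForms_cechd (p q : ℕ) (c : CX.Forms p q) :
    pullbackForms CX CY h τ hτ p (q + 1) (CX.cechd p q c) = CY.cechd p q (pullbackForms CX CY h τ hτ p q c) := by
  funext J
  rw [pullbackForms_apply, cechd_apply, cechd_apply, pullbackForms_apply, map_smul, d_pull]

/-- The pull-back commutes with the Čech differentials (`res_pull`). [cite: BottTu1982Forms, §8 (8.4)]
[cite: Hartshorne1975, Ch. II §1] -/
theorem pullbackForms_cechδ (p q : ℕ) (c : CX.Forms p q) :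
    pullbackForms CX CY h τ hτ (p + 1) q (CX.cechδ p q c) = CY.cechδ p q (pullbackForms CX CY h τ hτ p q c) := by
  funext J
  rw [pullbackForms_apply, cechδ_apply, cechδ_apply, map_sum]
  refine Finset.sum_congr rfl fun j _ ↦ ?_
  rw [map_smul, pullbackForms_apply]
  exact congrArg _ (res_pull CX CY h τ hτ J (Fin.succAbove j) (c ((τ ∘ J) ∘ Fin.succAbove j))).symm

/-- **The pull-back is a morphism of algebraic Čech–de Rham double complexes**
`Č(𝔘, Ω•_{alg,X}) → Č(𝔙, Ω•_{alg,Y})` along `(h, τ)` — functoriality of the algebraic de Rham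
(hyper)cohomology computed on affine covers [Hartshorne1975, Ch. II §1 Thm. (1.4)]; for `h = 𝟙` it
is the refinement map. [cite: Hartshorne1975, Ch. II §1, Thm. (1.4)]
[cite: CattaniElZeinGriffithsLe2014, Ch. 2 §2.9.2 (p. 109)] -/
def pullbackHom : CX.cechDeRham.Hom CY.cechDeRham where
  f p q := pullbackForms CX CY h τ hτ p q
  f_d p q c := pullbackForms_cechd CX CY h τ hτ p q c
  f_δ p q c := pullbackForms_cechδ CX CY h τ hτ p q c

/-- The same morphism with scalars restricted to `ℝ` (the source of the realisation morphism
`realizeHom` is `cechDeRhamℝ`). [cite: Weibel1994, 1.2.4] -/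
def pullbackHomℝ : CX.cechDeRhamℝ.Hom CY.cechDeRhamℝ where
  f p q := (pullbackForms CX CY h τ hτ p q).restrictScalars ℝ
  f_d p q c := pullbackForms_cechd CX CY h τ hτ p q c
  f_δ p q c := pullbackForms_cechδ CX CY h τ hτ p q c

/-- Components of `pullbackHomℝ`. [cite: Weibel1994, 1.2.4] -/
@[simp]
theorem pullbackHomℝ_f_apply (p q : ℕ) (c : CX.Forms p q) :
    (pullbackHomℝ CX CY h τ hτ).f p q c = pullbackForms CX CY h τ hτ p q c :=
  rfl

end CoverCharts

end Algebraic

/-! ### §3 The realisation morphisms intertwine the algebraic and the smooth pull-backs -/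

open Literature.NumberTheory.Transcendental Literature.Geometry.Kaehler

section Realization

variable {E : Type} [NormedAddCommGroup E] [NormedSpace ℂ E] [FiniteDimensional ℂ E] {m : ℕ}
  {E' : Type} [NormedAddCommGroup E'] [NormedSpace ℂ E'] [FiniteDimensional ℂ E'] {m' : ℕ}
  {X Y : Motives.SchemeOver ℂ}

namespace AnalyticModel

/-- **The analytified restriction `(h|_{V → U})^an` is `h^an` on the open pieces**, pointwise:
`(h|)^an z = h^an z` in `X^an` for `z ∈ ψ_Y⁻¹V(ℂ)` (functoriality of analytification,
`anMap_comp_anMap`, and `ι^an = Subtype.val`). [cite: SerreGAGA1956, §2 n°5] -/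
theorem val_anMap_restrictOpen_resLE (B : AnalyticModel E' m' Y) (A : AnalyticModel E m X)
    (h : Y ⟶ X) {U₀ : X.left.Opens} {V₀ : Y.left.Opens} (e : V₀ ≤ h.left ⁻¹ᵁ U₀) (z : B.openSet V₀) :
    Subtype.val ((B.restrictOpen V₀).anMap (A.restrictOpen U₀) (Motives.openSubschemeOverResLE h e) z) =
      B.anMap A h z := by
  have h1 := congrFun (AnalyticModel.anMap_comp_anMap (B.restrictOpen V₀) (A.restrictOpen U₀) A
    (Motives.openSubschemeOverResLE h e) (Motives.openSubschemeOverι X U₀)) z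
  have h2 := congrFun (AnalyticModel.anMap_comp_anMap (B.restrictOpen V₀) B A
    (Motives.openSubschemeOverι Y V₀) h) z
  have h3 := A.anMap_restrictOpen_ι_apply U₀
    ((B.restrictOpen V₀).anMap (A.restrictOpen U₀) (Motives.openSubschemeOverResLE h e) z)
  have h4 := B.anMap_restrictOpen_ι_apply V₀ z
  rw [Motives.openSubschemeOverResLE_comp_ι] at h1
  exact h3.symm.trans ((h1.trans h2.symm).trans (congrArg (B.anMap A h) h4))

/-- `(h|)^an = h^an` on the open pieces, as maps. [cite: SerreGAGA1956, §2 n°5] -/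
theorem val_comp_anMap_restrictOpen_resLE (B : AnalyticModel E' m' Y) (A : AnalyticModel E m X)
    (h : Y ⟶ X) {U₀ : X.left.Opens} {V₀ : Y.left.Opens} (e : V₀ ≤ h.left ⁻¹ᵁ U₀) :
    Subtype.val ∘ (B.restrictOpen V₀).anMap (A.restrictOpen U₀) (Motives.openSubschemeOverResLE h e) =
      B.anMap A h ∘ Subtype.val :=
  funext fun z ↦ B.val_anMap_restrictOpen_resLE A h e z

/-- `h^an` maps the open piece over `V₀ ⊆ h⁻¹U₀` into the open piece over `U₀`
(`ψ_X ∘ h^an = h(ℂ) ∘ ψ_Y`). [cite: SerreGAGA1956, §2 n°5] -/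
theorem openSet_le_preimage_openSet (B : AnalyticModel E' m' Y) (A : AnalyticModel E m X) (h : Y ⟶ X)
    {U₀ : X.left.Opens} {V₀ : Y.left.Opens} (e : V₀ ≤ h.left ⁻¹ᵁ U₀) :
    (B.openSet V₀ : Set B.carrier) ⊆ B.anMap A h ⁻¹' (A.openSet U₀ : Set A.carrier) := by
  intro z hz
  rw [Set.mem_preimage, SetLike.mem_coe, A.mem_openSet_iff, B.toComplexPoints_anMap A h,
    Motives.AlgPoints.pt_map]
  exact e ((B.mem_openSet_iff V₀ z).1 hz)

/-- The open cover `𝔙^an` of `Y^an` maps into `𝔘^an` under `h^an`: `ψ_Y⁻¹V_j(ℂ) ⊆ (h^an)⁻¹ ψ_X⁻¹U_{τj}(ℂ)`.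
[cite: SerreGAGA1956, §2 n°5] -/
theorem coverSet_subset_preimage_coverSet (B : AnalyticModel E' m' Y) (A : AnalyticModel E m X)
    (h : Y ⟶ X) {ι : Type u} {ι' : Type v} {U : ι → X.left.Opens} {V : ι' → Y.left.Opens}
    {τ : ι' → ι} (hτ : ∀ j, V j ≤ h.left ⁻¹ᵁ U (τ j)) (j : ι') :
    B.coverSet V j ⊆ B.anMap A h ⁻¹' A.coverSet U (τ j) :=
  B.openSet_le_preimage_openSet A h (hτ j)

end AnalyticModel

namespace CoverCharts

variable {ι : Type u} {ι' : Type v} {U : ι → X.left.Opens} {V : ι' → Y.left.Opens}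
  [IsAffineCover U] [IsAffineCover V] [SmoothOfRelativeDimension m X.hom]
  [SmoothOfRelativeDimension m' Y.hom]
  (CX : CoverCharts X U) (CY : CoverCharts Y V) (h : Y ⟶ X) (τ : ι' → ι)
  (hτ : ∀ j, V j ≤ h.left ⁻¹ᵁ U (τ j)) (A : AnalyticModel E m X) (B : AnalyticModel E' m' Y)

/-- **The local realisations intertwine the algebraic and the smooth pull-backs**: on the open
piece `ψ_Y⁻¹V_J(ℂ)`, the holomorphic image of `h|^* r` is `(h^an)^*` of the holomorphic image of
`r` on `ψ_X⁻¹U_{τJ}(ℂ)` — Grothendieck's comparison (5) is natural (`regularFormRealize_pullback_anMap`,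
node P2-nat) along `h| : Y|_{V_J} ⟶ X|_{U_{τJ}}`, whose analytification is `h^an` on the open pieces.
[cite: Grothendieck1966, (5)–(6)] [cite: SerreGAGA1956, §2 n°5] -/
theorem realizeOn_pull {p : ℕ} (J : Fin (p + 1) → ι') (q : ℕ) (r : RegularForm (CX.ideal (τ ∘ J)) q) :
    B.realizeOn (CY.coord J) le_rfl q (pull CX CY h τ hτ J q r) =
      ((A.realizeOn (CX.coord (τ ∘ J)) le_rfl q r).pullback 𝓘(ℝ, E') (B.anMap A h)).restr
        (B.openSet (cechOpen V J) : Set B.carrier) := by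
  rw [AnalyticModel.realizeOn_apply, AnalyticModel.realizeOn_apply, pull]
  refine (congrArg (MForm.extendZero (U := B.openSet (cechOpen V J)))
    (regularFormRealize_pullback_anMap (B.restrictOpen (cechOpen V J))
      (A.restrictOpen (cechOpen U (τ ∘ J))) (cechResLE h τ hτ J) (liftAlong_spec CX CY h τ hτ J)
      le_rfl le_rfl (map_liftAlong_le CX CY h τ hτ J) q r).symm).trans ?_
  exact MForm.extendZero_pullback_of_val_comp
    (B.val_comp_anMap_restrictOpen_resLE A h (cechOpen_le_preimage_cechOpen h hτ J))
    (((B.restrictOpen (cechOpen V J)).contMDiff_anMap (A.restrictOpen (cechOpen U (τ ∘ J)))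
      (cechResLE h τ hτ J)).mdifferentiable (by simp))
    (fun y _ ↦ ((B.contMDiff_anMap A h).mdifferentiable (by simp)) y) _

/-- **The realisation morphisms intertwine the pull-backs**, componentwise:
`realize_Y ∘ h^*_alg = (h^an)^*_smooth ∘ realize_X` on `Č^p(𝔘, Ω^q_alg)`.
[cite: Grothendieck1966, p. 96 (6)] [cite: CattaniElZeinGriffithsLe2014, Ch. 2 §2.9.2 (p. 109)] -/
theorem realize_pullbackForms (p q : ℕ) (c : CX.Forms p q) :
    CY.realize B p q (pullbackForms CX CY h τ hτ p q c) =
      Literature.Geometry.Kaehler.cechPullback 𝓘(ℝ, E) 𝓘(ℝ, E') ℂ (B.isOpen_coverSet V)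
        (B.contMDiff_anMap A h) τ (B.coverSet_subset_preimage_coverSet A h hτ) p q
        (CX.realize A p q c) := by
  funext J
  apply Subtype.ext
  rw [coe_realize_apply, Literature.Geometry.Kaehler.coe_cechPullback_apply, coe_realize_apply,
    B.cechSet_coverSet V J, pullbackForms_apply]
  exact realizeOn_pull CX CY h τ hτ A B J q (c (τ ∘ J))

end CoverCharts

end Realization

/-! ### §4 The square on total cohomology and the naturality of the realisation map -/

/-- **Commutative squares of double-complex morphisms induce commutative squares on total
cohomology**: if `ψ ∘ φ = ψ' ∘ φ'` componentwise then `Hⁿ(Tot ψ) ∘ Hⁿ(Tot φ) = Hⁿ(Tot ψ') ∘ Hⁿ(Tot φ')`.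
[cite: Weibel1994, 1.2.6] -/
theorem _root_.Literature.Algebra.Homology.ADoubleComplex.Hom.totCohMap_comm {R : Type*} [CommRing R]
    {X₁ : ℕ → ℕ → Type*} [∀ p q, AddCommGroup (X₁ p q)] [∀ p q, Module R (X₁ p q)]
    {X₂ : ℕ → ℕ → Type*} [∀ p q, AddCommGroup (X₂ p q)] [∀ p q, Module R (X₂ p q)]
    {X₃ : ℕ → ℕ → Type*} [∀ p q, AddCommGroup (X₃ p q)] [∀ p q, Module R (X₃ p q)]
    {X₄ : ℕ → ℕ → Type*} [∀ p q, AddCommGroup (X₄ p q)] [∀ p q, Module R (X₄ p q)]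
    {K₁ : ADoubleComplex R X₁} {K₂ : ADoubleComplex R X₂} {K₃ : ADoubleComplex R X₃}
    {K₄ : ADoubleComplex R X₄} (φ : K₁.Hom K₂) (ψ : K₂.Hom K₄) (φ' : K₁.Hom K₃) (ψ' : K₃.Hom K₄)
    (hc : ∀ p q (x : X₁ p q), ψ.f p q (φ.f p q x) = ψ'.f p q (φ'.f p q x)) (n : ℕ)
    (c : NatCochain.Cohomology K₁.totD n) :
    ψ.totCohMap n (φ.totCohMap n c) = ψ'.totCohMap n (φ'.totCohMap n c) := by
  obtain ⟨z, rfl⟩ := NatCochain.Cohomology.mk_surjective _ n c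
  simp only [ADoubleComplex.Hom.totCohMap, NatCochain.Cohomology.map_mk]
  congr 1
  apply Subtype.ext
  apply Subtype.ext
  simp only [NatCochain.Cohomology.coe_mapCocycles, ADoubleComplex.Hom.coe_totTn]
  funext p q
  simp only [ADoubleComplex.Hom.total_apply]
  exact hc p q _

section Cohomology

variable {E : Type} [NormedAddCommGroup E] [NormedSpace ℂ E] [FiniteDimensional ℂ E] {m : ℕ}
  {E' : Type} [NormedAddCommGroup E'] [NormedSpace ℂ E'] [FiniteDimensional ℂ E'] {m' : ℕ}
  {X Y : Motives.SchemeOver ℂ} {ι : Type u} {ι' : Type v} {U : ι → X.left.Opens} {V : ι' → Y.left.Opens}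
  [IsAffineCover U] [IsAffineCover V] [SmoothOfRelativeDimension m X.hom]
  [SmoothOfRelativeDimension m' Y.hom] [Fintype ι] [Fintype ι']

namespace CoverCharts

variable (CX : CoverCharts X U) (CY : CoverCharts Y V) (h : Y ⟶ X) (τ : ι' → ι)
  (hτ : ∀ j, V j ≤ h.left ⁻¹ᵁ U (τ j)) (A : AnalyticModel E m X) (B : AnalyticModel E' m' Y)
  (hU : ⨆ i, U i = ⊤) (hV : ⨆ j, V j = ⊤)

omit [Fintype ι] [Fintype ι'] in
/-- **The realisation on total cohomology intertwines the pull-backs**: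
`Hⁿ(Tot realize_Y) ∘ Hⁿ(Tot h^*_alg) = Hⁿ(Tot (h^an)^*) ∘ Hⁿ(Tot realize_X)`.
[cite: Grothendieck1966, p. 96 (6)] [cite: Weibel1994, 1.2.6] -/
theorem realizeTotCohMap_totCohMap_pullbackHomℝ (n : ℕ) (c : NatCochain.Cohomology CX.cechDeRhamℝ.totD n) :
    CY.realizeTotCohMap B n ((pullbackHomℝ CX CY h τ hτ).totCohMap n c) =
      (Literature.Geometry.Kaehler.cechPullbackHom 𝓘(ℝ, E) 𝓘(ℝ, E') ℂ (A.isOpen_coverSet U)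
        (B.isOpen_coverSet V) (B.contMDiff_anMap A h) τ
        (B.coverSet_subset_preimage_coverSet A h hτ)).totCohMap n (CX.realizeTotCohMap A n c) :=
  ADoubleComplex.Hom.totCohMap_comm _ _ _ _ (fun p q x ↦ realize_pullbackForms CX CY h τ hτ A B p q x) n c

/-- **Naturality of the realisation map of Route P**: realising the pulled-back algebraic
Čech–de Rham class on `Y^an` is pulling back the realised class along `h^an` —
`realizeDeRham_Y ∘ Hⁿ(Tot h^*) = Hⁿ((h^an)^*) ∘ realizeDeRham_X`, where `Hⁿ((h^an)^*)` is the map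
induced on `Hⁿ(Ω•(X^an), d) → Hⁿ(Ω•(Y^an), d)` by the pull-back of global forms (the smooth edge
maps `Hⁿ(Ω•) ≅ Hⁿ(Tot Č(𝔘^an, Ω))` are natural, `RowAugmentation.Hom.totMap_cohMap`, and bijective,
Bott–Tu Prop. 8.8). [cite: Grothendieck1966, p. 96 (6)] [cite: BottTu1982Forms, Prop. 8.8]
[cite: CattaniElZeinGriffithsLe2014, Ch. 2 §2.9.2 (p. 109)] -/
theorem realizeDeRham_totCohMap_pullbackHomℝ (n : ℕ) (c : NatCochain.Cohomology CX.cechDeRhamℝ.totD n) :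
    CY.realizeDeRham B hV n ((pullbackHomℝ CX CY h τ hτ).totCohMap n c) =
      (Literature.Geometry.Kaehler.cechPullbackRowHom 𝓘(ℝ, E) 𝓘(ℝ, E') ℂ (A.isOpen_coverSet U)
        (B.isOpen_coverSet V) (B.contMDiff_anMap A h) τ
        (B.coverSet_subset_preimage_coverSet A h hτ)).cohMap n (CX.realizeDeRham A hU n c) := by
  apply (B.bijective_cechDeRhamRow_totMap V hV n).1
  rw [CoverCharts.totMap_realizeDeRham, ADoubleComplex.RowAugmentation.Hom.totMap_cohMap,
    CoverCharts.totMap_realizeDeRham]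
  exact realizeTotCohMap_totCohMap_pullbackHomℝ CX CY h τ hτ A B n c

/-- **Naturality of the realisation map, read in complex de Rham cohomology**:
`(h^an)^* (realizeDeRham_X c) = realizeDeRham_Y (h^* c)` in `H^n_dR(Y^an; ℂ)` (through
`localCohomologyEquivComplexDeRham` and `complexDeRhamCohomology.map h^an`).
[cite: Grothendieck1966, p. 96 (6)] [cite: CattaniElZeinGriffithsLe2014, Ch. 2 §2.9.2 (p. 109)] -/
theorem map_anMap_realizeDeRham (n : ℕ) (c : NatCochain.Cohomology CX.cechDeRhamℝ.totD n) :
    complexDeRhamCohomology.map E' (B.contMDiff_anMap A h) n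
        (localCohomologyEquivComplexDeRham n (CX.realizeDeRham A hU n c)) =
      localCohomologyEquivComplexDeRham n
        (CY.realizeDeRham B hV n ((pullbackHomℝ CX CY h τ hτ).totCohMap n c)) := by
  rw [realizeDeRham_totCohMap_pullbackHomℝ CX CY h τ hτ A B hU hV,
    Literature.Geometry.Kaehler.localCohomologyEquivComplexDeRham_cohMap_cechPullbackRowHom]

end CoverCharts

/-- **Independence of the cover (refinement)**: for two finite affine covers `𝔘`, `𝔙` of the SAME
smooth `X` with `V_j ⊆ U_{τ j}` and one analytic model `A`, the realised class of the refined
cocycle is the realised class of the cocycle: `realizeDeRham_𝔙 (refine c) = realizeDeRham_𝔘 c` in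
`H^n_dR(X^an; ℂ)` (`h = 𝟙`, `(𝟙)^an = id`). [cite: BottTu1982Forms, Prop. 8.8]
[cite: CattaniElZeinGriffithsLe2014, Ch. 2 §2.9.2 (p. 109)] -/
theorem CoverCharts.localCohomologyEquivComplexDeRham_realizeDeRham_refine {V' : ι' → X.left.Opens}
    [IsAffineCover V'] (CX : CoverCharts X U) (CV : CoverCharts X V') (τ : ι' → ι)
    (hτ : ∀ j, V' j ≤ (𝟙 X : X ⟶ X).left ⁻¹ᵁ U (τ j)) (A : AnalyticModel E m X) (hU : ⨆ i, U i = ⊤)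
    (hV : ⨆ j, V' j = ⊤) (n : ℕ) (c : NatCochain.Cohomology CX.cechDeRhamℝ.totD n) :
    localCohomologyEquivComplexDeRham n (CV.realizeDeRham A hV n ((pullbackHomℝ CX CV (𝟙 X) τ hτ).totCohMap n c)) =
      localCohomologyEquivComplexDeRham n (CX.realizeDeRham A hU n c) := by
  rw [← CoverCharts.map_anMap_realizeDeRham CX CV (𝟙 X) τ hτ A A hU hV n c,
    complexDeRhamCohomology.map_congr (A.contMDiff_anMap A (𝟙 X)) contMDiff_id A.anMap_id n,
    complexDeRhamCohomology.map_id, LinearMap.id_apply]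

end Cohomology

/-! ### §5 The torsor step: on a smooth AFFINE `Y`, pulled-back realised classes are classes of
global algebraic forms -/

section TorsorStep

variable {E : Type} [NormedAddCommGroup E] [NormedSpace ℂ E] [FiniteDimensional ℂ E] {m : ℕ}
  {E' : Type} [NormedAddCommGroup E'] [NormedSpace ℂ E'] [FiniteDimensional ℂ E'] {m' : ℕ}
  {X Y : Motives.SchemeOver ℂ} {ι : Type u} {U : ι → X.left.Opens}
  [IsAffine Y.left]

/-- **A finite basic-open refinement of `h⁻¹𝔘` on an affine `Y`**: if the `U_i` cover `X` and
`φ_{y₀} : ℂ[T] → Γ(Y, 𝒪)` is onto, there are finitely many polynomials `G_k` with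
`(φ_{y₀}(G_k))_k = Γ(Y, 𝒪)` (so the `D(φ_{y₀} G_k)` cover `Y`) and each `D(φ_{y₀} G_k)` inside some
`h⁻¹ U_{τ k}` (the basic opens form a basis of the affine `Y`, which is quasi-compact).
[cite: Hartshorne1977, II §2 Prop. 2.2] [cite: CattaniElZeinGriffithsLe2014, Ch. 2 §2.9.2 (p. 109)] -/
theorem exists_basicCover_refining (h : Y ⟶ X) (hU : ⨆ i, U i = ⊤) {N₀ : ℕ}
    {y₀ : Fin N₀ → Γ(Y.left, ⊤)} (hy₀ : Function.Surjective (coordPresentation Y y₀)) :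
    ∃ (K : Type) (_ : Fintype K) (G : K → MvPolynomial (Fin N₀) ℂ) (τ : K → ι),
      Ideal.span (Set.range fun k ↦ coordPresentation Y y₀ (G k)) = ⊤ ∧
        ∀ k, basicCover y₀ G k ≤ h.left ⁻¹ᵁ U (τ k) := by
  classical
  -- every point has a basic open neighbourhood inside some `h⁻¹ U_i`
  have hpt : ∀ y : Y.left, ∃ (i : ι) (g : Γ(Y.left, ⊤)),
      Y.left.basicOpen g ≤ h.left ⁻¹ᵁ U i ∧ y ∈ Y.left.basicOpen g := by
    intro y
    have hy : h.left.base y ∈ (⨆ i, U i) := by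
      rw [hU]
      trivial
    obtain ⟨i, hi⟩ := TopologicalSpace.Opens.mem_iSup.1 hy
    obtain ⟨g, hg, hyg⟩ := (isAffineOpen_top Y.left).exists_basicOpen_le (V := h.left ⁻¹ᵁ U i) ⟨y, hi⟩
      (TopologicalSpace.Opens.mem_top y)
    exact ⟨i, g, hg, hyg⟩
  choose i g hg hyg using hpt
  obtain ⟨t, ht⟩ := isCompact_univ.elim_finite_subcover
    (fun y : Y.left ↦ ((Y.left.basicOpen (g y) : Y.left.Opens) : Set Y.left))
    (fun y ↦ (Y.left.basicOpen (g y)).isOpen) (fun y _ ↦ Set.mem_iUnion.2 ⟨y, hyg y⟩)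
  have hGk : ∀ k : ↥t, coordPresentation Y y₀ (hy₀ (g k)).choose = g k := fun k ↦ (hy₀ (g k)).choose_spec
  refine ⟨↥t, inferInstance, fun k ↦ (hy₀ (g k)).choose, fun k ↦ i k, ?_, fun k ↦ ?_⟩
  · simp_rw [hGk]
    refine ((isAffineOpen_top Y.left).iSup_basicOpen_eq_self_iff).1 ?_
    rw [iSup_range' (fun f ↦ Y.left.basicOpen f) (fun k : ↥t ↦ g k)]
    refine top_le_iff.1 fun y _ ↦ ?_
    obtain ⟨k, hk, hyk⟩ := Set.mem_iUnion₂.1 (ht (Set.mem_univ y))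
    exact TopologicalSpace.Opens.mem_iSup.2 ⟨⟨k, hk⟩, hyk⟩
  · change Y.left.basicOpen (coordPresentation Y y₀ (hy₀ (g k)).choose) ≤ _
    rw [hGk k]
    exact hg k

variable [IsAffineCover U] [SmoothOfRelativeDimension m X.hom] [Fintype ι]
  [SmoothOfRelativeDimension m' Y.hom]
  (C : CoverCharts X U) (A : AnalyticModel E m X) (B : AnalyticModel E' m' Y) (h : Y ⟶ X)
  (hU : ⨆ i, U i = ⊤) {N₀ : ℕ} {y₀ : Fin N₀ → Γ(Y.left, ⊤)}
  (hy₀ : Function.Surjective (coordPresentation Y y₀))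

/-- A smooth `ℂ`-scheme (of some relative dimension) is locally of finite type. [cite: Hartshorne1977, III Prop. 10.1] -/
theorem locallyOfFiniteType_of_smoothOfRelativeDimension (m' : ℕ) (Y : Motives.SchemeOver ℂ)
    [SmoothOfRelativeDimension m' Y.hom] : LocallyOfFiniteType Y.hom := by
  haveI : Smooth Y.hom := SmoothOfRelativeDimension.smooth m' Y.hom
  infer_instance

include hy₀ in
/-- **THE TORSOR STEP OF ROUTE P (node P5).** Let `X` be a smooth `ℂ`-scheme with a finite affine
open cover `𝔘`, charts `C` and an analytic model `A`; let `h : Y ⟶ X` be ANY `ℂ`-morphism from a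
smooth AFFINE `Y` (e.g. Jouanolou's affine torsor) with analytic model `B` and onto presentation
`φ_{y₀}`. Then for every algebraic Čech–de Rham class `c` of `(X, 𝔘)`, the pull-back
`(h^an)^* (realizeDeRham c) ∈ H^n_dR(Y^an; ℂ)` of its realised class lies in the image of
Grothendieck's comparison map of `Y`: it is the class of the holomorphic image of ONE global
closed algebraic `n`-form on `Y`. Proof: refine `h⁻¹𝔘` by a finite basic-open cover `𝔙` of `Y`
(`exists_basicCover_refining`); by naturality (`CoverCharts.map_anMap_realizeDeRham`) the class is
`realizeDeRham_𝔙 (h^* c)`, and on the affine `Y` the augmented Čech rows of `𝔙` are exact (Serre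
vanishing in Čech form, `rowExact_of_basicCover`), so the realised classes of `𝔙` are exactly the
image of `deRhamComparison` (`range_realizeDeRham_eq_of_basicCover`) — El Zein–Tu §2.9.2 / Grothendieck
(4): «if X is affine … ℍ(X, Ω•) = H(Γ(X, Ω•))». [cite: Grothendieck1966, p. 96 (4)–(6)]
[cite: CattaniElZeinGriffithsLe2014, Ch. 2 §2.9.2 (p. 109)] -/
theorem map_anMap_realizeDeRham_mem_range_deRhamComparison (n : ℕ)
    (c : NatCochain.Cohomology C.cechDeRhamℝ.totD n) :
    complexDeRhamCohomology.map E' (B.contMDiff_anMap A h) n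
        (localCohomologyEquivComplexDeRham n (C.realizeDeRham A hU n c)) ∈
      Set.range (deRhamComparison B y₀ le_rfl n) := by
  haveI : LocallyOfFiniteType Y.hom := locallyOfFiniteType_of_smoothOfRelativeDimension m' Y
  obtain ⟨K, hK, G, τ, hcov, hτ⟩ := exists_basicCover_refining h hU hy₀
  let CY : CoverCharts Y (basicCover y₀ G) := CoverCharts.ofIsAffineCover (basicCover y₀ G)
  rw [CoverCharts.map_anMap_realizeDeRham C CY h τ hτ A B hU (iSup_basicCover_eq_top hcov) n c,
    ← range_realizeDeRham_eq_of_basicCover y₀ G CY B hy₀ hcov n]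
  exact Set.mem_range_self _

include hy₀ in
/-- The same, as an inclusion of images: `(h^an)^* (im realizeDeRham_X) ⊆ im deRhamComparison_Y`.
[cite: Grothendieck1966, p. 96 (4)–(6)] -/
theorem range_map_anMap_realizeDeRham_subset (n : ℕ) :
    Set.range (fun c : NatCochain.Cohomology C.cechDeRhamℝ.totD n ↦
        complexDeRhamCohomology.map E' (B.contMDiff_anMap A h) n
          (localCohomologyEquivComplexDeRham n (C.realizeDeRham A hU n c))) ⊆
      Set.range (deRhamComparison B y₀ le_rfl n) := by
  rintro _ ⟨c, rfl⟩
  exact map_anMap_realizeDeRham_mem_range_deRhamComparison C A B h hU hy₀ n c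

/-- **The torsor step in the language of form expressions**: `(h^an)^* (realizeDeRham c)` is the class
of the realisation `ξ.realize B` of an algebraic `n`-form expression `ξ = Σ f dg₁ ∧ ⋯ ∧ dg_n` on `Y`
with closed realisation (the shape of the tree's fact (G) `grothendieck_comparison_realize_surjective`,
for these classes). [cite: Grothendieck1966, Thm. 1'] [cite: CattaniElZeinGriffithsLe2014, Ch. 2 §2.9.2 (p. 109)] -/
theorem exists_realize_eq_map_anMap_realizeDeRham (n : ℕ) (c : NatCochain.Cohomology C.cechDeRhamℝ.totD n) :
    ∃ (ξ : AlgFormExpr Y n) (hξ : ξ.realize B ∈ cclosedSmoothForms E' B.carrier n),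
      complexDeRhamCohomology.mk E' B.carrier n ⟨ξ.realize B, hξ⟩ =
        complexDeRhamCohomology.map E' (B.contMDiff_anMap A h) n
          (localCohomologyEquivComplexDeRham n (C.realizeDeRham A hU n c)) := by
  haveI : LocallyOfFiniteType Y.hom := locallyOfFiniteType_of_smoothOfRelativeDimension m' Y
  obtain ⟨N₀, y₀, hy₀⟩ := exists_coordPresentation_surjective Y
  obtain ⟨γ, hγ⟩ := map_anMap_realizeDeRham_mem_range_deRhamComparison C A B h hU hy₀ n c
  obtain ⟨r, rfl⟩ := DeRhamCohomology.mk_surjective _ γ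
  obtain ⟨α, hα⟩ := RegularForm.mk_surjective _ (r : RegularForm (RingHom.ker (coordPresentation Y y₀)) n)
  have hreal : (PolyForm.toAlgFormExpr y₀ α).realize B = regularFormRealize B y₀ le_rfl n r := by
    rw [realize_toAlgFormExpr, ← regularFormRealize_mk B y₀ le_rfl, hα]
  refine ⟨PolyForm.toAlgFormExpr y₀ α, hreal ▸ regularFormRealize_mem_cclosedSmoothForms B y₀ le_rfl n r.2, ?_⟩
  rw [← hγ, deRhamComparison_mk]
  congr 1
  exact Subtype.ext hreal

include hy₀ in
/-- **Route P, assembled modulo its analytic half (P3 + P4).** If the realisation map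
`realizeDeRham : Hⁿ(Tot Č(𝔘, Ω•_alg)) → H^n_dR(X^an; ℂ)` of a finite affine cover of `X` is ONTO (the
GAGA/Dolbeault comparison on `E₁`, nodes P3–P4 of the lane) and `(h^an)^*` is onto (Jouanolou's affine
torsor: `π^*` bijective), then Grothendieck's comparison map of the smooth affine `Y` is onto in degree
`n` — the surjectivity half of [Grothendieck1966, Thm. 1′] for `Y`, WITHOUT resolution of singularities
(ibid. p. 96: «if X is complete … the result is elementary»). [cite: Grothendieck1966, Thm. 1']
[cite: CattaniElZeinGriffithsLe2014, Ch. 2 §2.9.2 (p. 109)] -/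
theorem surjective_deRhamComparison_of_surjective_realizeDeRham (n : ℕ)
    (hP : Function.Surjective (fun c : NatCochain.Cohomology C.cechDeRhamℝ.totD n ↦
      localCohomologyEquivComplexDeRham n (C.realizeDeRham A hU n c)))
    (hJ : Function.Surjective (complexDeRhamCohomology.map E' (B.contMDiff_anMap A h) n)) :
    Function.Surjective (deRhamComparison B y₀ le_rfl n) := by
  intro x
  obtain ⟨x', rfl⟩ := hJ x
  obtain ⟨c, rfl⟩ := hP x'
  exact map_anMap_realizeDeRham_mem_range_deRhamComparison C A B h hU hy₀ n c

/-- **(G) for `(Y, B, n)` from Route P**: under the hypotheses of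
`surjective_deRhamComparison_of_surjective_realizeDeRham`, every class of `H^n_dR(Y^an; ℂ)` is the
class of the realisation of an algebraic `n`-form expression on `Y` — the conclusion of the tree's
named fact `grothendieck_comparison_realize_surjective` for `(Y, B, n)`
(`exists_realize_eq_of_deRhamComparison_surjective`). [cite: Grothendieck1966, Thm. 1'] -/
theorem exists_realize_eq_of_surjective_realizeDeRham (n : ℕ)
    (hP : Function.Surjective (fun c : NatCochain.Cohomology C.cechDeRhamℝ.totD n ↦
      localCohomologyEquivComplexDeRham n (C.realizeDeRham A hU n c)))
    (hJ : Function.Surjective (complexDeRhamCohomology.map E' (B.contMDiff_anMap A h) n))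
    (x : complexDeRhamCohomology E' B.carrier n) :
    ∃ (ξ : AlgFormExpr Y n) (hξ : ξ.realize B ∈ cclosedSmoothForms E' B.carrier n),
      complexDeRhamCohomology.mk E' B.carrier n ⟨ξ.realize B, hξ⟩ = x := by
  haveI : LocallyOfFiniteType Y.hom := locallyOfFiniteType_of_smoothOfRelativeDimension m' Y
  obtain ⟨N₀, y₀, hy₀⟩ := exists_coordPresentation_surjective Y
  exact exists_realize_eq_of_deRhamComparison_surjective B y₀ le_rfl
    (surjective_deRhamComparison_of_surjective_realizeDeRham C A B h hU hy₀ n hP hJ) x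

end TorsorStep

end Literature.AlgebraicGeometry.HodgeTheory

end
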